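import Literature.NumberTheory.EllipticCurves.CPMuDescentK3BoxSplitNodeKill
import HarnessLib

/-!
# The `α`-box over `ℚ` CUT by the local condition at a split node prime: the cubic-residue kill
# (Cohen–Pazuki 2009, Thm. 2.1 (3) with the local image at a prime `p₀ ≡ 1 (mod 3)` of bad nodal reduction off the `3`-torsion point)

Topic `NumberTheory/EllipticCurves`. The ℚ-side counterpart of `CPMuDescentK3BoxNodeKill`. For `E₂ = threeTorsionModel m₂ s₂ :
y² = x³ + (m₂x + s₂)²` and a prime `p₀ ∉ S`, `p₀ ≡ 1 (mod 3)`, `p₀ ∤ s₂`, `p₀ ∣ 27s₂ − 4m₂³` (the isogenous curve has a NODE at `p₀` away from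
`(0, s₂)`), every value of the descent map `α = y − (m₂x + s₂)` on `E₂(ℚ_{p₀})` is `c³(1 + ε)` (`ThreeTorsionDescentLocalImageNode`), so a
Selmer candidate `u = ∏_{q ∈ S} q^{e_q}` must be a CUBE modulo `p₀`. With residue CERTIFICATES `q ≡ g^{c_q} y_q³ (mod p₀)` against a fixed
non-cube `g` (`g^{(p₀−1)/3} ≢ 1`) this is ONE linear relation `3 ∣ ∑ c_q e_q`; the surviving hyperplane of the crude box `⟨[q] : q ∈ S⟩` is
spanned by `[q · q₀^{f_q}]`, `q ≠ q₀`, for a pivot `q₀` (`3 ∤ c_{q₀}`, `3 ∣ c_q + c_{q₀} f_q`), so `|S| − 1` rational points book the ℚ-side: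
* `three_dvd_of_pow_mul_cube_eq_cube_zmod` — `g^n t³ = s³` in `𝔽_{p₀}`, `t ≠ 0`, `g` a non-cube ⟹ `3 ∣ n`;
* `exists_sub_pow_three_mem_of_eq_cube_mul_numberField` — `x = β³(1 + ε)` in `K_w`, `x ∈ 𝓞 K` ⟹ `x ≡ y³ (mod w)` (any number field);
* `prod_pow_cubeClass_mem_of_basis` — the hyperplane `3 ∣ ∑ c_q e_q` of `⟨[q]⟩` is generated by the `[q · q₀^{f_q}]`;
* **`cubeClass_mem_closure_of_torsorClass_mem_sha_QKill`** — `[C_u] ∈ Ш(V/ℚ) ⟹ [u] ∈ ⟨[α(P)] : P ∈ E₂(ℚ)⟩` from `S`, the node prime `p₀`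
  with certificates, and the `|S| − 1` twisted generators.
Theorems only; no definitions, no named facts.

## References
* [CohenPazuki2009] H. Cohen, F. Pazuki, *Elementary 3-descent with a 3-isogeny*, Acta Arith. 140 (2009), Thm. 2.1 (2)–(3), Prop. 2.2.
* [SilvermanAEC2009] J. H. Silverman, *The Arithmetic of Elliptic Curves*, 2nd ed. (2009), Thm. X.4.2 (a), Prop. X.4.9.
* [IrelandRosen1990] K. Ireland, M. Rosen, GTM 84, Ch. 9 §1 (cubic residues in `𝔽_p`).
-/

noncomputable section

open scoped Classical
open WeierstrassCurve IsDedekindDomain IsDedekindDomain.HeightOneSpectrum NumberField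

namespace Literature.NumberTheory.EllipticCurves

namespace CPMuDescent

open MordellDescent ThreeTorsionDescent MuThreeKernel WithZero
open Literature.NumberTheory.NumberFields

/-! ## Cubic residues in `𝔽_{p₀}` -/

/-- **`g^n t³ = s³` in `𝔽_p` with `t ≠ 0` and `g^{(p−1)/3} ≠ 1` (`p ≡ 1 (mod 3)`) forces `3 ∣ n`**: raising to the power `(p−1)/3` and using
Fermat, `ω^n = 1` for `ω = g^{(p−1)/3}`, an element of order `3`. [cite: IrelandRosen1990, Ch. 9 §1] -/
theorem three_dvd_of_pow_mul_cube_eq_cube_zmod {p : ℕ} [hp : Fact p.Prime] (hp1 : p % 3 = 1) {g t s : ZMod p}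
    (hg : g ^ ((p - 1) / 3) ≠ 1) (hg0 : g ≠ 0) (ht : t ≠ 0) {n : ℕ} (h : g ^ n * t ^ 3 = s ^ 3) : 3 ∣ n := by
  haveI : Fact (Nat.Prime 3) := ⟨Nat.prime_three⟩
  set k := (p - 1) / 3 with hk
  have h3k : 3 * k = p - 1 := by
    have : 3 ∣ p - 1 := by have := hp.out.two_le; omega
    rw [hk]; exact Nat.mul_div_cancel' this
  have hs : s ≠ 0 := by
    rintro rfl
    rw [zero_pow three_ne_zero] at h
    rcases mul_eq_zero.mp h with h1 | h1
    · exact hg0 (pow_eq_zero_iff' |>.mp h1).1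
    · exact ht (pow_eq_zero_iff three_ne_zero |>.mp h1)
  have htk : t ^ (3 * k) = 1 := by rw [h3k]; exact ZMod.pow_card_sub_one_eq_one ht
  have hsk : s ^ (3 * k) = 1 := by rw [h3k]; exact ZMod.pow_card_sub_one_eq_one hs
  have hω3 : (g ^ k) ^ 3 = 1 := by rw [← pow_mul, mul_comm, h3k]; exact ZMod.pow_card_sub_one_eq_one hg0
  have hωn : (g ^ k) ^ n = 1 := by
    have e := congrArg (fun z => z ^ k) h
    simp only [mul_pow, ← pow_mul] at e
    rw [show 3 * k = 3 * k from rfl, htk, hsk, mul_one] at e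
    rw [← pow_mul, mul_comm]; exact e
  have hord : orderOf (g ^ k) = 3 := orderOf_eq_prime hω3 hg
  exact hord ▸ orderOf_dvd_of_pow_eq_one hωn

/-! ## Residues: from the completion to `𝓞 K / w` (any number field) -/

/-- **`x = β³(1 + ε)` in `K_w` with `x ∈ 𝓞 K`, `v(ε) < 1` ⟹ `x ≡ y³ (mod w)` for some `y ∈ 𝓞 K`** (the number-field form of
`exists_sub_pow_three_mem_of_eq_cube_mul`). [cite: SilvermanAEC2009, Prop. X.4.9] -/
theorem exists_sub_pow_three_mem_of_eq_cube_mul_numberField {K : Type*} [Field K] [NumberField K]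
    (w : HeightOneSpectrum (𝓞 K)) {x : 𝓞 K} {β ε : w.adicCompletion K} (hε : Valued.v ε < 1)
    (h : algebraMap K (w.adicCompletion K) (x : K) = β ^ 3 * (1 + ε)) : ∃ y : 𝓞 K, x - y ^ 3 ∈ w.asIdeal := by
  have h1ε : Valued.v (1 + ε) = 1 := Valued.v.map_one_add_of_lt hε
  have hval' : ∀ z : K, Valued.v (algebraMap K (w.adicCompletion K) z) = w.valuation K z :=
    fun z => valuedAdicCompletion_eq_valuation' w z
  have hxv : Valued.v (algebraMap K (w.adicCompletion K) (x : K)) ≤ 1 := by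
    rw [hval']
    exact valuation_le_one w x
  have hβ : Valued.v β ≤ 1 := by
    have e : Valued.v β ^ 3 ≤ 1 := by
      have := hxv
      rw [h, map_mul, map_pow, h1ε, mul_one] at this
      exact this
    rcases lt_or_ge 1 (Valued.v β) with hgt | hle
    · exact absurd e (not_le.mpr (one_lt_pow₀ hgt three_ne_zero))
    · exact hle
  set O := w.adicCompletionIntegers K with hO
  let βO : O := ⟨β, (mem_adicCompletionIntegers (𝓞 K) K w).mpr hβ⟩
  let εO : O := ⟨ε, (mem_adicCompletionIntegers (𝓞 K) K w).mpr hε.le⟩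
  let xO : O := algebraMap (𝓞 K) O x
  have hxO : (xO : w.adicCompletion K) = algebraMap K (w.adicCompletion K) (x : K) := by
    rw [Literature.NumberTheory.NumberFields.coe_algebraMap_adicCompletionIntegers_eq K w x]
  have hid : xO = βO ^ 3 * (1 + εO) := by
    apply Subtype.ext
    push_cast
    rw [hxO]
    exact h
  obtain ⟨ρ, hρ, hker⟩ := Literature.NumberTheory.NumberFields.exists_ringHom_adicCompletionIntegers_extending' K w
    (Ideal.Quotient.mk w.asIdeal) Ideal.Quotient.mk_surjective Ideal.mk_ker
  have hρε : ρ εO = 0 := (hker εO).mpr hε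
  obtain ⟨y, hy⟩ := Ideal.Quotient.mk_surjective (ρ βO)
  refine ⟨y, Ideal.Quotient.eq.mp ?_⟩
  rw [map_pow, hy, ← hρ x, ← map_pow]
  change ρ xO = ρ (βO ^ 3)
  rw [hid, map_mul, map_add, map_one, hρε, add_zero, mul_one]

/-! ## Integers of `ℚ`: membership in a finite place -/

/-- **`z ∈ v ↔ p ∣ e(z)`** for `z ∈ 𝓞 ℚ`, `p = natGenerator v`, `e : 𝓞 ℚ ≃ ℤ` (bookkeeping, private). [folklore] -/
private theorem mem_asIdeal_iff_natGenerator_dvd_intEquiv (v : HeightOneSpectrum (𝓞 ℚ)) (z : 𝓞 ℚ) :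
    z ∈ v.asIdeal ↔ ((Rat.HeightOneSpectrum.natGenerator v : ℕ) : ℤ) ∣ Rat.IsIntegralClosure.intEquiv (𝓞 ℚ) z := by
  rw [← Ideal.mem_span_singleton, Rat.HeightOneSpectrum.span_natGenerator, Ideal.apply_mem_of_equiv_iff]

/-- `v(x) = exp(−ord_p x)` for the place `v` of `ℚ` over `p = natGenerator v` (private copy of the bridge).
[cite: CohenPazuki2009, Theorem 2.1 (2)] -/
private theorem valuation_eq_exp_neg_padicValRat₃ (v : HeightOneSpectrum (𝓞 ℚ)) {x : ℚ} (hx : x ≠ 0) :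
    v.valuation ℚ x = exp (-padicValRat (Rat.HeightOneSpectrum.natGenerator v) x) := by
  haveI hp : Fact (Rat.HeightOneSpectrum.natGenerator v).Prime := ⟨Rat.HeightOneSpectrum.prime_natGenerator v⟩
  haveI hp' : Fact (Nat.Prime ((Rat.HeightOneSpectrum.primesEquiv v : Nat.Primes) : ℕ)) :=
    ⟨(Rat.HeightOneSpectrum.primesEquiv v).2⟩
  have hequiv := Rat.HeightOneSpectrum.valuation_equiv_padicValuation v
  set n : ℤ := padicValRat (Rat.HeightOneSpectrum.natGenerator v) x with hn
  have h2x : Rat.padicValuation (Rat.HeightOneSpectrum.primesEquiv v) x = exp (-n) := by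
    change Rat.padicValuation (Rat.HeightOneSpectrum.natGenerator v) x = _
    simp [Rat.padicValuation, hx, hn]
  have h2p : Rat.padicValuation (Rat.HeightOneSpectrum.primesEquiv v)
      ((Rat.HeightOneSpectrum.natGenerator v : ℚ) ^ n) = exp (-n) := by
    change Rat.padicValuation (Rat.HeightOneSpectrum.natGenerator v) _ = _
    rw [map_zpow₀, Rat.padicValuation_self, ← exp_zsmul]
    simp
  have h1p : v.valuation ℚ ((Rat.HeightOneSpectrum.natGenerator v : ℚ) ^ n) = exp (-n) := by
    rw [map_zpow₀, Literature.NumberTheory.GaloisRepresentations.Rat.valuation_natGenerator, ← exp_zsmul]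
    simp
  rw [← h1p]
  exact (hequiv.eq_iff).mpr (h2x.trans h2p.symm)

/-! ## The surviving hyperplane from its twisted basis -/

/-- `[∏_{q ∈ T} q^{e_q}] = ∏_{q ∈ T} [q]^{e_q}` for a set `T` of primes. [cite: CohenPazuki2009, Theorem 2.1] -/
theorem cubeClass_prod_pow_eq (T : Finset ℕ) (hT : ∀ q ∈ T, q.Prime) (e : ℕ → ℕ) :
    cubeClass (∏ q ∈ T, (q : ℚ) ^ e q) = ∏ q ∈ T, cubeClass (q : ℚ) ^ e q := by
  induction T using Finset.induction_on with
  | empty => rw [Finset.prod_empty, Finset.prod_empty, cubeClass_one]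
  | insert p T hpT ih =>
    have hp : p.Prime := hT p (Finset.mem_insert_self p T)
    have hT' : ∀ q ∈ T, q.Prime := fun q hq => hT q (Finset.mem_insert_of_mem hq)
    have hne : ∏ q ∈ T, (q : ℚ) ^ e q ≠ 0 :=
      Finset.prod_ne_zero_iff.mpr fun q hq => pow_ne_zero _ (Nat.cast_ne_zero.mpr (hT' q hq).ne_zero)
    rw [Finset.prod_insert hpT, Finset.prod_insert hpT,
      cubeClass_mul (pow_ne_zero _ (Nat.cast_ne_zero.mpr hp.ne_zero)) hne,
      cubeClass_pow' (Nat.cast_ne_zero.mpr hp.ne_zero), ih hT']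

/-- `x^n = x^{n % 3}` in `ℚ*/ℚ*³` (every class has order dividing `3`). [cite: CohenPazuki2009, Theorem 2.1] -/
theorem cubeClass_pow_eq_pow_mod_three {x : ℚ} (hx : x ≠ 0) (n : ℕ) : cubeClass x ^ n = cubeClass x ^ (n % 3) := by
  have h3 : cubeClass x ^ 3 = 1 := by rw [← cubeClass_pow' hx, cubeClass_pow_three]
  conv_lhs => rw [← Nat.div_add_mod n 3, pow_add, pow_mul, h3, one_pow, one_mul]

/-- **The surviving hyperplane is generated by the twisted basis**: in `ℚ*/ℚ*³`, if `3 ∣ ∑_{q ∈ S} c_q e_q`, `3 ∤ c_{q₀}` (`q₀ ∈ S`) and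
`3 ∣ c_q + c_{q₀} f_q` for `q ≠ q₀`, then `∏_{q ∈ S} [q]^{e_q}` lies in any subgroup containing the `[q · q₀^{f_q}]`, `q ∈ S ∖ {q₀}`.
[cite: CohenPazuki2009, Theorem 2.1 (3)] -/
theorem prod_pow_cubeClass_mem_of_basis (S : Finset ℕ) (hS : ∀ q ∈ S, q.Prime) (G : Subgroup (CubeUnits ℚ))
    {q₀ : ℕ} (hq₀ : q₀ ∈ S) (c f e : ℕ → ℕ) (hc₀ : ¬ 3 ∣ c q₀) (hf : ∀ q ∈ S, q ≠ q₀ → 3 ∣ c q + c q₀ * f q)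
    (hgen : ∀ q ∈ S, q ≠ q₀ → cubeClass ((q : ℚ) * (q₀ : ℚ) ^ f q) ∈ G) (he : 3 ∣ ∑ q ∈ S, c q * e q) :
    cubeClass (∏ q ∈ S, (q : ℚ) ^ e q) ∈ G := by
  set S' := S.erase q₀ with hS'
  have hq₀0 : (q₀ : ℚ) ≠ 0 := Nat.cast_ne_zero.mpr (hS q₀ hq₀).ne_zero
  have hq0 : ∀ q ∈ S', (q : ℚ) ≠ 0 := fun q hq => Nat.cast_ne_zero.mpr (hS q (Finset.mem_of_mem_erase hq)).ne_zero
  set C₀ := cubeClass (q₀ : ℚ) with hC₀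
  -- the twisted basis `D q = [q]·[q₀]^{f q}`
  have hD : ∀ q ∈ S', cubeClass (q : ℚ) ^ e q =
      cubeClass ((q : ℚ) * (q₀ : ℚ) ^ f q) ^ e q * (C₀ ^ (f q * e q))⁻¹ := by
    intro q hq
    rw [cubeClass_mul (hq0 q hq) (pow_ne_zero _ hq₀0), cubeClass_pow' hq₀0, mul_pow, ← pow_mul, mul_inv_cancel_right]
  have hsplit : cubeClass (∏ q ∈ S, (q : ℚ) ^ e q) = C₀ ^ e q₀ * ∏ q ∈ S', cubeClass (q : ℚ) ^ e q := by
    rw [cubeClass_prod_pow_eq S hS e, ← Finset.mul_prod_erase S _ hq₀]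
  rw [hsplit, Finset.prod_congr rfl hD, Finset.prod_mul_distrib, Finset.prod_inv_distrib, Finset.prod_pow_eq_pow_sum]
  -- goal: `C₀ ^ e q₀ * ((∏ D_q ^ e_q) * (C₀ ^ F)⁻¹) ∈ G`
  -- exponent bookkeeping: `e q₀ ≡ ∑_{S'} f q e q (mod 3)`
  set F := ∑ q ∈ S', f q * e q with hF
  have hsum : 3 ∣ c q₀ * e q₀ + ∑ q ∈ S', c q * e q := by
    rwa [← Finset.add_sum_erase S _ hq₀] at he
  have hsum' : (3 : ℤ) ∣ ∑ q ∈ S', ((c q * e q : ℕ) : ℤ) + (c q₀ : ℤ) * F := by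
    have h1 : (3 : ℤ) ∣ ∑ q ∈ S', (((c q * e q : ℕ) : ℤ) + (c q₀ : ℤ) * ((f q * e q : ℕ) : ℤ)) :=
      Finset.dvd_sum fun q hq => by
        obtain ⟨d, hd⟩ := hf q (Finset.mem_of_mem_erase hq) (Finset.ne_of_mem_erase hq)
        have hd' : ((c q : ℤ) + c q₀ * f q) = 3 * d := by exact_mod_cast hd
        refine ⟨(d : ℤ) * e q, ?_⟩
        push_cast
        linear_combination (e q : ℤ) * hd'
    rw [Finset.sum_add_distrib, ← Finset.mul_sum] at h1
    rw [hF]; push_cast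
    exact h1
  have hmod : e q₀ % 3 = F % 3 := by
    have h2 : (3 : ℤ) ∣ (c q₀ : ℤ) * e q₀ + ∑ q ∈ S', ((c q * e q : ℕ) : ℤ) := by exact_mod_cast hsum
    have h3 : (3 : ℤ) ∣ (c q₀ : ℤ) * ((e q₀ : ℤ) - F) := by
      have := Int.dvd_sub h2 hsum'
      rw [show (c q₀ : ℤ) * e q₀ + ∑ q ∈ S', ((c q * e q : ℕ) : ℤ) - (∑ q ∈ S', ((c q * e q : ℕ) : ℤ) + (c q₀ : ℤ) * F) =
        (c q₀ : ℤ) * ((e q₀ : ℤ) - F) by ring] at this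
      exact this
    rcases (Int.prime_three.dvd_or_dvd h3) with h4 | h4
    · exact absurd (by exact_mod_cast h4) hc₀
    · omega
  have hcancel : C₀ ^ e q₀ * (C₀ ^ F)⁻¹ = 1 := by
    rw [cubeClass_pow_eq_pow_mod_three hq₀0 (e q₀), cubeClass_pow_eq_pow_mod_three hq₀0 F, hmod, mul_inv_cancel]
  rw [mul_left_comm, hcancel, mul_one]
  exact Subgroup.prod_mem G fun q hq => G.pow_mem (hgen q (Finset.mem_of_mem_erase hq) (Finset.ne_of_mem_erase hq)) _

/-! ## The `α`-box over `ℚ` cut at a split node prime -/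

variable {a b t m₂ s₂ : ℚ}

/-- **`[C_u] ∈ Ш(V/ℚ) ⟹ [u] ∈ ⟨[α(P)] : P ∈ E₂(ℚ)⟩` when the box CUT at a split node prime is filled by points.** Inputs: `S` outside which
`v_p(2s₂) = 0 ≤ v_p(2m₂)`; a prime `p₀ ∉ S`, `p₀ ≡ 1 (mod 3)`, `v_{p₀}(s₂) = 0 < v_{p₀}(27s₂ − 4m₂³)`; a non-cube `g` mod `p₀` with residue
certificates `q ≡ g^{c_q} y_q³ (mod p₀)` (`q ∈ S`, `p₀ ∤ y_q`); a pivot `q₀ ∈ S` with `3 ∤ c_{q₀}` and twists `f_q` (`3 ∣ c_q + c_{q₀} f_q`); and the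
`|S| − 1` classes `[q · q₀^{f_q}]`, `q ≠ q₀`, in the subgroup generated by the descent classes of rational points. At `ℚ_{p₀}` the locally trivial
torsor gives `α(P)^e = u w³`, the node lemma gives `u = c³(1 + ε)`, so `∏ q^{e_q} ≡ cube (mod p₀)` and `3 ∣ ∑ c_q e_q`.
[cite: CohenPazuki2009, Theorem 2.1 (2)–(3) and Proposition 2.2] [cite: SilvermanAEC2009, Prop. X.4.9] -/
theorem cubeClass_mem_closure_of_torsorClass_mem_sha_QKill (hb : b ≠ 0) (hd : 4 * a ^ 3 + 9 * b ≠ 0) (ht : t ≠ 0)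
    (hm₂ : t * m₂ = 3 * a) (hs₂ : t ^ 3 * s₂ = 4 * a ^ 3 + 9 * b) (S : Finset ℕ) (hS : ∀ p ∈ S, p.Prime)
    (hout : ∀ p : ℕ, p.Prime → p ∉ S → padicValRat p (2 * s₂) = 0 ∧ 0 ≤ padicValRat p (2 * m₂))
    {p₀ : ℕ} (hp₀ : p₀.Prime) (hp₀1 : p₀ % 3 = 1)
    (hsp : padicValRat p₀ s₂ = 0) (hDp : 0 < padicValRat p₀ (27 * s₂ - 4 * m₂ ^ 3))
    {g : ℕ} (hg : (g : ZMod p₀) ^ ((p₀ - 1) / 3) ≠ 1) (hg0 : (g : ZMod p₀) ≠ 0)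
    (c y : ℕ → ℕ) (hcert : ∀ q ∈ S, ((q : ℕ) : ZMod p₀) = (g : ZMod p₀) ^ c q * ((y q : ℕ) : ZMod p₀) ^ 3)
    (hy0 : ∀ q ∈ S, ((y q : ℕ) : ZMod p₀) ≠ 0)
    {q₀ : ℕ} (hq₀ : q₀ ∈ S) (hc₀ : ¬ 3 ∣ c q₀) (f : ℕ → ℕ) (hf : ∀ q ∈ S, q ≠ q₀ → 3 ∣ c q + c q₀ * f q)
    (hgenQ : ∀ q ∈ S, q ≠ q₀ → cubeClass ((q : ℚ) * (q₀ : ℚ) ^ f q) ∈ Subgroup.closure (Set.range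
      fun P : (threeTorsionModel m₂ s₂).toAffine.Point => descentClass (threeTorsionModel m₂ s₂) m₂ s₂ P))
    {u : ℚ} (hu : u ≠ 0) (hsha : (kernelDatum hb hd).torsorClass hu ∈ (cpCurve a b).sha) :
    cubeClass u ∈ Subgroup.closure (Set.range
      fun P : (threeTorsionModel m₂ s₂).toAffine.Point => descentClass (threeTorsionModel m₂ s₂) m₂ s₂ P) := by
  set G := Subgroup.closure (Set.range
      fun P : (threeTorsionModel m₂ s₂).toAffine.Point => descentClass (threeTorsionModel m₂ s₂) m₂ s₂ P) with hG
  haveI : Fact p₀.Prime := ⟨hp₀⟩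
  have hs0 : s₂ ≠ 0 := s₂_ne_zero hd hs₂
  obtain ⟨e, -, hcl⟩ := cubeClass_eq_prod_of_support S hS hu fun p hp hpS =>
    three_dvd_padicValRat_of_torsorClass_mem_sha hb hd ht hm₂ hs₂ hu hsha p hp (hout p hp hpS).1 (hout p hp hpS).2
  rw [hcl]
  refine prod_pow_cubeClass_mem_of_basis S hS G hq₀ c f e hc₀ hf hgenQ ?_
  -- it remains: `3 ∣ ∑ c_q e_q`, from the local condition at `p₀`
  set v : HeightOneSpectrum (𝓞 ℚ) := (Rat.HeightOneSpectrum.primesEquiv (R := 𝓞 ℚ)).symm ⟨p₀, hp₀⟩ with hv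
  have hvp : Rat.HeightOneSpectrum.natGenerator v = p₀ := by
    have : (Rat.HeightOneSpectrum.primesEquiv (R := 𝓞 ℚ) v : ℕ) = p₀ := by
      rw [hv, Equiv.apply_symm_apply]
    exact this
  obtain ⟨P, w, e', hw, hP⟩ :=
    exists_descent_pow_eq_adicCompletion_of_torsorClass_mem_sha hb hd ht hm₂ hs₂ hu hsha v
  set L := v.adicCompletion ℚ with hL
  set φ : ℚ →+* L := @algebraMap ℚ L _ _
    (IsDedekindDomain.HeightOneSpectrum.instAlgebraAdicCompletion (𝓞 ℚ) ℚ v) with hφ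
  have hval : ∀ x : ℚ, Valued.v (φ x) = v.valuation ℚ x := fun x => valuedAdicCompletion_eq_valuation' v x
  have hp₀2 : p₀ ≠ 2 := by omega
  have hp₀3 : p₀ ≠ 3 := by omega
  have hvnat : ∀ n : ℕ, n ≠ 0 → ¬ p₀ ∣ n → Valued.v (φ n) = 1 := by
    intro n hn hdvd
    rw [hval, valuation_eq_exp_neg_padicValRat₃ v (Nat.cast_ne_zero.mpr hn), hvp, padicValRat.of_nat,
      padicValNat.eq_zero_of_not_dvd hdvd]
    simp
  have h2L : Valued.v (2 : L) = 1 := by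
    rw [← map_ofNat φ 2, show (OfNat.ofNat 2 : ℚ) = ((2 : ℕ) : ℚ) by norm_num]
    exact hvnat 2 two_ne_zero fun h => hp₀2 ((Nat.prime_dvd_prime_iff_eq hp₀ Nat.prime_two).mp h)
  have h3L : Valued.v (3 : L) = 1 := by
    rw [← map_ofNat φ 3, show (OfNat.ofNat 3 : ℚ) = ((3 : ℕ) : ℚ) by norm_num]
    exact hvnat 3 three_ne_zero fun h => hp₀3 ((Nat.prime_dvd_prime_iff_eq hp₀ Nat.prime_three).mp h)
  have hsL : Valued.v (φ s₂) = 1 := by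
    rw [hval, valuation_eq_exp_neg_padicValRat₃ v hs0, hvp, hsp, neg_zero, exp_zero]
  have hD0 : 27 * s₂ - 4 * m₂ ^ 3 ≠ 0 := fun h0 => by
    rw [h0, padicValRat.zero] at hDp; exact lt_irrefl _ hDp
  have hDL : Valued.v (27 * φ s₂ - 4 * φ m₂ ^ 3) < 1 := by
    rw [show (27 : L) * φ s₂ - 4 * φ m₂ ^ 3 = φ (27 * s₂ - 4 * m₂ ^ 3) by
      rw [map_sub, map_mul, map_mul, map_pow, map_ofNat, map_ofNat], hval, valuation_eq_exp_neg_padicValRat₃ v hD0, hvp,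
      ← exp_zero, exp_lt_exp]
    omega
  obtain ⟨cc, ε, -, hε, huc⟩ := (Valued.v : Valuation L ℤᵐ⁰).eq_cube_mul_one_add_of_threeTorsionDescent_pow_eq
    (W := threeTorsionModel (φ m₂) (φ s₂)) rfl h2L h3L hsL hDL hw hP
  -- `X = ∏ q^{e_q}` is `(cube)·(1 + ε)` in `ℚ_{p₀}`
  have hX0 : (∏ q ∈ S, (q : ℚ) ^ e q) ≠ 0 :=
    Finset.prod_ne_zero_iff.mpr fun q hq => pow_ne_zero _ (Nat.cast_ne_zero.mpr (hS q hq).ne_zero)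
  obtain ⟨r, hr, hur⟩ := (cubeClass_eq_cubeClass_iff hu hX0).mp hcl
  have hr' : φ r ≠ 0 := (map_ne_zero φ).mpr hr
  set XN : ℕ := ∏ q ∈ S, q ^ e q with hXN
  have hXQ : ((XN : 𝓞 ℚ) : ℚ) = ∏ q ∈ S, (q : ℚ) ^ e q := by
    rw [RingOfIntegers.coe_eq_algebraMap, map_natCast, hXN]; push_cast; rfl
  have hφeq : algebraMap ℚ L = φ := Subsingleton.elim _ _
  have hXL : algebraMap ℚ L ((XN : 𝓞 ℚ) : ℚ) = (cc / φ r) ^ 3 * (1 + ε) := by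
    rw [hφeq, hXQ, div_pow, div_mul_eq_mul_div, eq_div_iff (pow_ne_zero 3 hr')]
    rw [hur, map_mul, map_pow] at huc
    linear_combination huc
  obtain ⟨yI, hyI⟩ := exists_sub_pow_three_mem_of_eq_cube_mul_numberField (K := ℚ) v hε hXL
  -- read modulo `p₀`
  have hdvd : (p₀ : ℤ) ∣ (XN : ℤ) - (Rat.IsIntegralClosure.intEquiv (𝓞 ℚ) yI) ^ 3 := by
    have h1 := (mem_asIdeal_iff_natGenerator_dvd_intEquiv v _).mp hyI
    rwa [hvp, map_sub, map_pow, map_natCast] at h1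
  have hmodp : ((XN : ℕ) : ZMod p₀) = ((Rat.IsIntegralClosure.intEquiv (𝓞 ℚ) yI : ℤ) : ZMod p₀) ^ 3 := by
    have h2 := (ZMod.intCast_zmod_eq_zero_iff_dvd _ p₀).mpr hdvd
    push_cast at h2
    exact sub_eq_zero.mp h2
  -- `X ≡ g^{∑ c_q e_q} (∏ y_q^{e_q})³`
  have hXfac : ((XN : ℕ) : ZMod p₀) = (g : ZMod p₀) ^ (∑ q ∈ S, c q * e q) * (∏ q ∈ S, ((y q : ℕ) : ZMod p₀) ^ e q) ^ 3 := by
    rw [hXN, Nat.cast_prod]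
    simp_rw [Nat.cast_pow]
    rw [Finset.prod_congr rfl fun q hq => by rw [hcert q hq]]
    simp_rw [mul_pow, ← pow_mul]
    rw [Finset.prod_mul_distrib, Finset.prod_pow_eq_pow_sum, ← Finset.prod_pow]
    refine congrArg _ (Finset.prod_congr rfl fun q _ => ?_)
    ring
  have ht0 : (∏ q ∈ S, ((y q : ℕ) : ZMod p₀) ^ e q) ≠ 0 :=
    Finset.prod_ne_zero_iff.mpr fun q hq => pow_ne_zero _ (hy0 q hq)
  exact three_dvd_of_pow_mul_cube_eq_cube_zmod hp₀1 hg hg0 ht0 (hXfac.symm.trans hmodp)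

end CPMuDescent

end Literature.NumberTheory.EllipticCurves

end
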